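import Summits.QuantumFields.YangMills.Theorems.IR.EsPolymerDecoupling
import Summits.QuantumFields.YangMills.Theorems.IR.EsPolymerDefsK

/-!
# Crux `IR` (item stmt-QuantumFields-19354) — line «es-polymer-decoupling», reshaped engine, input (a): COVARIANCES OF
RADIUS-`k` BLOCK OBSERVABLES REDUCE TO THE HARD-CORE GAS (near families)

Helper module for item `stmt-QuantumFields-19354` (`--supports … --as helper`; it closes nothing; lead prover
ym-ir-line-mxc-p1 g2).  The format-only half of the reshaped engine `PolymerEngineK` (`Theorems/IR/EsPolymerDefsK.lean`),
for an abstract representation `μ = ∑_Γ ν_Γ` (finite sum of sub-measures, `ν_Γ = 0` off compatible families):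

* `abs_cov_sub_gasCov_le_of_tags` — the tagged form of `abs_cov_sub_gasCov_le` (`Theorems/IR/EsPolymerDecoupling.lean`): if
  (D) the `ν_Γ`-means of `A`, `B` are `ν_Γ(1) Φ_A(τ_A Γ)`, `ν_Γ(1) Φ_B(τ_B Γ)` for arbitrary tag maps `τ_A, τ_B`, and (I)
  `ν_Γ(1) ∫AB dν_Γ = ∫A dν_Γ ∫B dν_Γ` on the compatible families satisfying a predicate `good`, then
  `|Cov_μ(A,B) − Cov_gas(Φ_A ∘ τ_A, Φ_B ∘ τ_B)| ≤ 2 C_A C_B · ∑_{Γ compatible, ¬ good Γ} ν_Γ(1)`;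
* `abs_cov_sub_gasCov_le_nearFamily` — the instance used by `DPRk`: tags = near families `nearFamily Γ c_A k`,
  `nearFamily Γ c_B k`, `good Γ = Disjoint (nearFamily Γ c_A k) (nearFamily Γ c_B k)`; the error is `2 C_A C_B` times the
  gas-probability that SOME polymer is near both blocks (a Peierls-small event when the blocks are far apart: such a polymer
  has `≥ (cellDist c_A c_B − 2k − 2)/6` cells).

HONEST FRAMING: bookkeeping for ONE input of an OPEN engine stub of a CONDITIONAL rung line; no clustering, no polymer
representation at weak coupling and no mass gap is proved here. -/

set_option autoImplicit false

noncomputable section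

open MeasureTheory Finset Function
open Literature.MathematicalPhysics.QuantumFieldTheory

namespace Summit.QuantumFields.YangMills.Cruxes.IR.EsPolymer

section Cov

variable {G : Type} [MeasurableSpace G] {N q : ℕ}
  (ν : Finset (Finset (Cell q)) → Measure (GaugeConfig 4 N G)) (μ : Measure (GaugeConfig 4 N G))
  [IsProbabilityMeasure μ] (hsum : Finset.univ.sum ν = μ) (hν0 : ∀ Γ, ¬ Compatible Γ → ν Γ = 0)

include hsum hν0

/-- The `μ`-mean of an observable with a tagged clause (D) is the gas-mean of `Φ ∘ τ`. -/
theorem integral_eq_sum_mass_mul_tag {α : Type*} {A : GaugeConfig 4 N G → ℝ} (hAm : Measurable A) {CA : ℝ}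
    (hA : ∀ U, |A U| ≤ CA) (τ : Finset (Finset (Cell q)) → α) (Φ : α → ℝ)
    (hΦ : ∀ Γ, Compatible Γ → ∫ U, A U ∂(ν Γ) = (ν Γ Set.univ).toReal * Φ (τ Γ)) :
    ∫ U, A U ∂μ = ∑ Γ, (ν Γ Set.univ).toReal * Φ (τ Γ) := by
  classical
  rw [integral_eq_sum_integral ν μ hsum hAm hA]
  refine sum_congr rfl fun Γ _ => ?_
  by_cases hΓ : Compatible Γ
  · exact hΦ Γ hΓ
  · rw [hν0 Γ hΓ]; simp

open Classical in
/-- **Covariances reduce to the gas (tagged form).**  With `P_Γ = ν_Γ(1)`, tag maps `τ_A, τ_B`, functionals `Φ_A, Φ_B`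
(clause (D)), and the independence clause (I) on the compatible families satisfying `good`:
`|Cov_μ(A,B) − (∑_Γ P_Γ Φ_A(τ_A Γ) Φ_B(τ_B Γ) − ∑ P Φ_A(τ_A Γ) · ∑ P Φ_B(τ_B Γ))| ≤ 2 C_A C_B ∑_{Γ compatible, ¬good} P_Γ`. -/
theorem abs_cov_sub_gasCov_le_of_tags [Nonempty G] {α α' : Type*} {A B : GaugeConfig 4 N G → ℝ} (hAm : Measurable A)
    (hBm : Measurable B) {CA CB : ℝ} (hA : ∀ U, |A U| ≤ CA) (hB : ∀ U, |B U| ≤ CB)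
    (good : Finset (Finset (Cell q)) → Prop) [DecidablePred good]
    (hI : ∀ Γ, Compatible Γ → good Γ →
      (ν Γ Set.univ).toReal * ∫ U, A U * B U ∂(ν Γ) = (∫ U, A U ∂(ν Γ)) * (∫ U, B U ∂(ν Γ)))
    (τA : Finset (Finset (Cell q)) → α) (τB : Finset (Finset (Cell q)) → α') (ΦA : α → ℝ) (ΦB : α' → ℝ)
    (hΦA : ∀ Γ, Compatible Γ → ∫ U, A U ∂(ν Γ) = (ν Γ Set.univ).toReal * ΦA (τA Γ))
    (hΦB : ∀ Γ, Compatible Γ → ∫ U, B U ∂(ν Γ) = (ν Γ Set.univ).toReal * ΦB (τB Γ)) :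
    |((∫ U, A U * B U ∂μ) - (∫ U, A U ∂μ) * (∫ U, B U ∂μ)) -
        ((∑ Γ, (ν Γ Set.univ).toReal * (ΦA (τA Γ) * ΦB (τB Γ))) -
          (∑ Γ, (ν Γ Set.univ).toReal * ΦA (τA Γ)) * (∑ Γ, (ν Γ Set.univ).toReal * ΦB (τB Γ)))| ≤
      2 * CA * CB * ∑ Γ ∈ Finset.univ.filter (fun Γ => Compatible Γ ∧ ¬ good Γ), (ν Γ Set.univ).toReal := by
  classical
  have hABm : Measurable fun U => A U * B U := hAm.mul hBm
  have hCA0 : 0 ≤ CA := (abs_nonneg _).trans (hA fun _ => Classical.arbitrary G)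
  have hAB : ∀ U, |A U * B U| ≤ CA * CB := fun U => by
    rw [abs_mul]; exact mul_le_mul (hA U) (hB U) (abs_nonneg _) hCA0
  rw [integral_eq_sum_integral ν μ hsum hABm hAB, integral_eq_sum_mass_mul_tag ν μ hsum hν0 hAm hA τA ΦA hΦA,
    integral_eq_sum_mass_mul_tag ν μ hsum hν0 hBm hB τB ΦB hΦB]
  have hsimp : ((∑ Γ, ∫ U, A U * B U ∂(ν Γ)) -
        (∑ Γ, (ν Γ Set.univ).toReal * ΦA (τA Γ)) * (∑ Γ, (ν Γ Set.univ).toReal * ΦB (τB Γ))) -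
      ((∑ Γ, (ν Γ Set.univ).toReal * (ΦA (τA Γ) * ΦB (τB Γ))) -
        (∑ Γ, (ν Γ Set.univ).toReal * ΦA (τA Γ)) * (∑ Γ, (ν Γ Set.univ).toReal * ΦB (τB Γ))) =
      ∑ Γ, ((∫ U, A U * B U ∂(ν Γ)) - (ν Γ Set.univ).toReal * (ΦA (τA Γ) * ΦB (τB Γ))) := by
    rw [sum_sub_distrib]; ring
  rw [hsimp]
  refine (abs_sum_le_sum_abs _ _).trans ?_
  -- termwise
  have hterm : ∀ Γ, |(∫ U, A U * B U ∂(ν Γ)) - (ν Γ Set.univ).toReal * (ΦA (τA Γ) * ΦB (τB Γ))| ≤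
      if Compatible Γ ∧ ¬ good Γ then 2 * CA * CB * (ν Γ Set.univ).toReal else 0 := by
    intro Γ
    haveI := isFiniteMeasure_sub ν μ hsum Γ
    set P : ℝ := (ν Γ Set.univ).toReal with hP
    have hP0 : 0 ≤ P := ENNReal.toReal_nonneg
    by_cases hΓ : Compatible Γ
    · by_cases hgood : good Γ
      · rw [if_neg (fun h => h.2 hgood)]
        -- independence clause (I): the term vanishes
        have hIΓ := hI Γ hΓ hgood
        rw [hΦA Γ hΓ, hΦB Γ hΓ] at hIΓ
        refine le_of_eq (abs_eq_zero.2 ?_)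
        rcases hP0.lt_or_eq with hPpos | hPzero
        · have : P * ((∫ U, A U * B U ∂(ν Γ)) - P * (ΦA (τA Γ) * ΦB (τB Γ))) = 0 := by
            rw [mul_sub, hIΓ]; ring
          rcases mul_eq_zero.1 this with h | h
          · exact absurd h hPpos.ne'
          · exact h
        · have hν : ν Γ = 0 := sub_eq_zero_of_mass ν (Γ := Γ) hPzero.symm
          rw [← hPzero, hν]; simp
      · rw [if_pos ⟨hΓ, hgood⟩]
        -- crude bound on the bad families
        have h1 : |∫ U, A U * B U ∂(ν Γ)| ≤ CA * CB * P := by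
          have h := norm_integral_le_of_norm_le_const (μ := ν Γ) (f := fun U => A U * B U) (C := CA * CB)
            (ae_of_all _ fun U => by rw [Real.norm_eq_abs]; exact hAB U)
          simpa [Real.norm_eq_abs, hP, Measure.real, mul_comm] using h
        have h2 : |P * (ΦA (τA Γ) * ΦB (τB Γ))| ≤ CA * CB * P := by
          have hAo : |P * ΦA (τA Γ)| ≤ CA * P := by
            rw [← hΦA Γ hΓ]
            have h := norm_integral_le_of_norm_le_const (μ := ν Γ) (f := A) (C := CA)
              (ae_of_all _ fun U => by rw [Real.norm_eq_abs]; exact hA U)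
            simpa [Real.norm_eq_abs, hP, Measure.real, mul_comm] using h
          have hBo : |P * ΦB (τB Γ)| ≤ CB * P := by
            rw [← hΦB Γ hΓ]
            have h := norm_integral_le_of_norm_le_const (μ := ν Γ) (f := B) (C := CB)
              (ae_of_all _ fun U => by rw [Real.norm_eq_abs]; exact hB U)
            simpa [Real.norm_eq_abs, hP, Measure.real, mul_comm] using h
          rcases hP0.lt_or_eq with hPpos | hPzero
          · have hA' : |ΦA (τA Γ)| ≤ CA := by
              rw [abs_mul, abs_of_pos hPpos] at hAo
              nlinarith
            have hB' : |ΦB (τB Γ)| ≤ CB := by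
              rw [abs_mul, abs_of_pos hPpos] at hBo
              nlinarith
            rw [abs_mul, abs_mul, abs_of_pos hPpos]
            calc P * (|ΦA (τA Γ)| * |ΦB (τB Γ)|) ≤ P * (CA * CB) :=
                  mul_le_mul_of_nonneg_left (mul_le_mul hA' hB' (abs_nonneg _) hCA0) hP0
              _ = CA * CB * P := by ring
          · rw [← hPzero]; simp
        calc |(∫ U, A U * B U ∂(ν Γ)) - P * (ΦA (τA Γ) * ΦB (τB Γ))|
            ≤ |∫ U, A U * B U ∂(ν Γ)| + |P * (ΦA (τA Γ) * ΦB (τB Γ))| := abs_sub _ _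
          _ ≤ CA * CB * P + CA * CB * P := add_le_add h1 h2
          _ = 2 * CA * CB * P := by ring
    · rw [if_neg (fun h => hΓ h.1)]
      have hPz : P = 0 := by rw [hP, hν0 Γ hΓ]; simp
      rw [hν0 Γ hΓ, hPz]; simp
  calc ∑ Γ, |(∫ U, A U * B U ∂(ν Γ)) - (ν Γ Set.univ).toReal * (ΦA (τA Γ) * ΦB (τB Γ))|
      ≤ ∑ Γ, (if Compatible Γ ∧ ¬ good Γ then 2 * CA * CB * (ν Γ Set.univ).toReal else 0) :=
        sum_le_sum fun Γ _ => hterm Γ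
    _ = 2 * CA * CB * ∑ Γ ∈ Finset.univ.filter (fun Γ => Compatible Γ ∧ ¬ good Γ), (ν Γ Set.univ).toReal := by
        rw [mul_sum, sum_filter]

open Classical in
/-- **The near-family instance (clauses (I)_k (D)_k of `DPRk`).**  The error term is `2 C_A C_B` times the gas-probability
that the near families of the two blocks INTERSECT (some polymer is near both). -/
theorem abs_cov_sub_gasCov_le_nearFamily [Nonempty G] {A B : GaugeConfig 4 N G → ℝ} (hAm : Measurable A)
    (hBm : Measurable B) {CA CB : ℝ} (hA : ∀ U, |A U| ≤ CA) (hB : ∀ U, |B U| ≤ CB) (k : ℕ) (cA cB : Cell q)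
    (hI : ∀ Γ, Compatible Γ → Disjoint (nearFamily Γ cA k) (nearFamily Γ cB k) →
      (ν Γ Set.univ).toReal * ∫ U, A U * B U ∂(ν Γ) = (∫ U, A U ∂(ν Γ)) * (∫ U, B U ∂(ν Γ)))
    (ΦA ΦB : Finset (Finset (Cell q)) → ℝ)
    (hΦA : ∀ Γ, Compatible Γ → ∫ U, A U ∂(ν Γ) = (ν Γ Set.univ).toReal * ΦA (nearFamily Γ cA k))
    (hΦB : ∀ Γ, Compatible Γ → ∫ U, B U ∂(ν Γ) = (ν Γ Set.univ).toReal * ΦB (nearFamily Γ cB k)) :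
    |((∫ U, A U * B U ∂μ) - (∫ U, A U ∂μ) * (∫ U, B U ∂μ)) -
        ((∑ Γ, (ν Γ Set.univ).toReal * (ΦA (nearFamily Γ cA k) * ΦB (nearFamily Γ cB k))) -
          (∑ Γ, (ν Γ Set.univ).toReal * ΦA (nearFamily Γ cA k)) *
            (∑ Γ, (ν Γ Set.univ).toReal * ΦB (nearFamily Γ cB k)))| ≤
      2 * CA * CB * ∑ Γ ∈ Finset.univ.filter
        (fun Γ => Compatible Γ ∧ ¬ Disjoint (nearFamily Γ cA k) (nearFamily Γ cB k)), (ν Γ Set.univ).toReal := by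
  classical
  exact abs_cov_sub_gasCov_le_of_tags ν μ hsum hν0 hAm hBm hA hB
    (fun Γ => Disjoint (nearFamily Γ cA k) (nearFamily Γ cB k)) hI (fun Γ => nearFamily Γ cA k)
    (fun Γ => nearFamily Γ cB k) ΦA ΦB hΦA hΦB

omit [IsProbabilityMeasure μ] hsum hν0 in
open Classical in
/-- **The bad event is a union over polymers near both blocks**: its gas-probability is at most the sum, over the cell sets
`γ` with a cell within `k+1` of `c_A` AND a cell within `k+1` of `c_B`, of the gas-probability that `γ ∈ Γ` (each of which
clause (P) bounds by `act γ ≤ p^{#γ}`, `sum_mass_filter_mem_le_act`). -/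
theorem sum_mass_not_disjoint_nearFamily_le (k : ℕ) (cA cB : Cell q) :
    ∑ Γ ∈ Finset.univ.filter (fun Γ => Compatible Γ ∧ ¬ Disjoint (nearFamily Γ cA k) (nearFamily Γ cB k)),
        (ν Γ Set.univ).toReal ≤
      ∑ γ ∈ Finset.univ.filter (fun γ : Finset (Cell q) =>
          (∃ c' ∈ γ, cellDist cA c' ≤ k + 1) ∧ ∃ c' ∈ γ, cellDist cB c' ≤ k + 1),
        ∑ Γ ∈ Finset.univ.filter (fun Γ => γ ∈ Γ), (ν Γ Set.univ).toReal := by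
  classical
  set D : Finset (Finset (Cell q)) := Finset.univ.filter fun γ : Finset (Cell q) =>
    (∃ c' ∈ γ, cellDist cA c' ≤ k + 1) ∧ ∃ c' ∈ γ, cellDist cB c' ≤ k + 1 with hDdef
  have hR : ∑ γ ∈ D, ∑ Γ ∈ Finset.univ.filter (fun Γ => γ ∈ Γ), (ν Γ Set.univ).toReal =
      ∑ Γ : Finset (Finset (Cell q)), ∑ γ ∈ D, if γ ∈ Γ then (ν Γ Set.univ).toReal else 0 := by
    simp_rw [sum_filter]
    rw [sum_comm]
  rw [sum_filter, hR]
  refine sum_le_sum fun Γ _ => ?_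
  have h0 : ∀ γ ∈ D, 0 ≤ (if γ ∈ Γ then (ν Γ Set.univ).toReal else 0) := fun γ _ => by
    split_ifs
    · exact ENNReal.toReal_nonneg
    · exact le_rfl
  split_ifs with hbad
  · obtain ⟨-, hnd⟩ := hbad
    obtain ⟨γ, hγA, hγB⟩ := not_disjoint_iff.1 hnd
    have hγD : γ ∈ D := mem_filter.2 ⟨mem_univ _, (mem_nearFamily.1 hγA).2, (mem_nearFamily.1 hγB).2⟩
    have hγΓ : γ ∈ Γ := (mem_nearFamily.1 hγA).1
    calc (ν Γ Set.univ).toReal = if γ ∈ Γ then (ν Γ Set.univ).toReal else 0 := by rw [if_pos hγΓ]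
      _ ≤ ∑ γ' ∈ D, if γ' ∈ Γ then (ν Γ Set.univ).toReal else 0 :=
          single_le_sum (f := fun γ' => if γ' ∈ Γ then (ν Γ Set.univ).toReal else 0) h0 hγD
  · exact sum_nonneg h0

end Cov

end Summit.QuantumFields.YangMills.Cruxes.IR.EsPolymer

end
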